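import Summits.CriticalPhenomena.PercolationContinuityZ3.Theorems.Transplant.FKDoubleFanWordCellsB3Free
import HarnessLib

/-!
# Double fans `K₂ ∨ P_{m+1}`: the identity rim word `I I I` is free — its polarized cell is the form `condA`, non-negative at every pair of
# parts generators for every `q ∈ [0,1]`

Helper file (`--supports stmt-CriticalPhenomena-4575`), FK sub-lane `prim-bschramm-fk-3` (gen 50); builds on p205010 (kernel theorem, internal
audit signed; external expert review pending).  No named facts, no sorries, default heartbeats; standard axioms.  Memo
`bschramm/prim-bschramm-fk-3/FAR-CROSS-XXV.md` §6.

After `…WordCellsWFree` / `…FreeRays` / `…B3Free` the parts condition of a rim word reduces to the 16 core pairs `{AC, 𝟙, R₀(w), R₁(w)}²`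
(`partsOK_of_core16`).  For the identity word `κ = (2,2,2)` (no `T_D`, no `W_D`) the middle word is DIAGONAL (the spoke operators are diagonal
in Plücker coordinates), and only the three coordinates `uv, xv, yz` are common to the supports of input and target bivectors — all of spoke
type `(1,1)`.  Hence (**`pcell2_III`**) `pcell2 q 2 2 2 x1 y1 x2 y2 P S = (1−q)(1−x1)(1−y1)(1−x2)(1−y2) · condA q P S` with the form
`condA q P S = P_xv S_xv + (1−q) P_yz S_yz − (2−q) P_uv S_uv` of `…OneSidedProducts`.  On the core generators `condA` is an explicit
non-negative polynomial (**`condA_core_nonneg`**): e.g. `condA(R₀(w), AC) = (2−q)(1−w²)`, `condA(R₁(w), 𝟙) = q(2−q)(1−w)²`, `condA(𝟙,𝟙) = 0`,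
and the three roof–roof forms are tensor-Bernstein combinations with non-negative integer coefficients in `(q, w_u, w_s) ∈ [0,1]³`.
Consequence (**`partsOK_III`**): `PartsOK q 2 2 2 x1 y1 x2 y2` for every `q ∈ [0,1]` and every spoke pattern in `[0,1]⁴` — the identity word
needs no certificate in any pattern campaign (MIN: 29 parts; JUN: the largest parts of the table).
[cite: Grimmett2006, §3.9 eq. (3.94) (pp. 63–64)] [folklore]
-/

noncomputable section

namespace Summit.CriticalPhenomena.PercolationContinuityZ3.Theorems

namespace FK

namespace ThreeApex

/-! ### The identity word is the form `condA` -/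

/-- **`pcell2 (2,2,2) = (1−q)·∏(1−x_i)(1−y_i)·condA`**: the diagonal middle word meets input and target supports only in the coordinates
`uv, xv, yz`, all of spoke type `(1,1)`. [folklore] -/
theorem pcell2_III (q x1 y1 x2 y2 : ℝ) (P S : P6) :
    pcell2 q 2 2 2 x1 y1 x2 y2 P S = (1 - q) * ((1 - x1) * (1 - y1) * ((1 - x2) * (1 - y2))) * condA q P S := by
  simp only [pcell2, rimOp, opAC, opBC, opTa, opWa, opTb, opWb, Biv.lin3, Biv.add, Biv.smul, inputBiv, targetBiv, pairH, condA]
  ring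

/-! ### `condA` at the core generators -/

section CondA

variable {q : ℝ}

/-- `condA` is symmetric. [folklore] -/
theorem condA_comm (q : ℝ) (P S : P6) : condA q P S = condA q S P := by
  simp only [condA]; ring

/-- `condA(AC, S) = S_xv`. [folklore] -/
theorem condA_rayAC_left (q : ℝ) (S : P6) : condA q rayAC S = S.xv := by
  simp only [condA, rayAC]; ring

/-- `condA(𝟙, S) = S_xv + (1−q) S_yz − (2−q) S_uv`. [folklore] -/
theorem condA_rayOne_left (q : ℝ) (S : P6) : condA q rayOne S = S.xv + (1 - q) * S.yz - (2 - q) * S.uv := by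
  simp only [condA, rayOne]; ring

/-- `condA(𝟙, 𝟙) = 0`. [folklore] -/
theorem condA_rayOne_rayOne (q : ℝ) : condA q rayOne rayOne = 0 := by
  simp only [condA, rayOne]; ring

/-- `condA(𝟙, R₀(w)) = (2−q)(1−w)²`. [folklore] -/
theorem condA_rayOne_roofR0 (q w : ℝ) : condA q rayOne (roofR0 q w) = (2 - q) * (1 - w) ^ 2 := by
  simp only [condA, rayOne, roofR0, xwR, zwR]; ring

/-- `condA(𝟙, R₁(w)) = q(2−q)(1−w)²`. [folklore] -/
theorem condA_rayOne_roofR1 (q w : ℝ) : condA q rayOne (roofR1 q w) = q * (2 - q) * (1 - w) ^ 2 := by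
  simp only [condA, rayOne, roofR1, xwR, zwR]; ring

/-- `condA(R₀(w_u), R₀(w_s))` as a tensor-Bernstein combination with non-negative coefficients. [folklore] -/
theorem condA_roofR0_roofR0 (q wu ws : ℝ) : condA q (roofR0 q wu) (roofR0 q ws) =
    4 * (1 - q) ^ (2:ℕ) * (1 - wu) ^ (2:ℕ) * (1 - ws) ^ (2:ℕ) + 8 * (1 - q) ^ (2:ℕ) * (1 - wu) ^ (2:ℕ) * ws * (1 - ws) +
    8 * (1 - q) ^ (2:ℕ) * wu * (1 - wu) * (1 - ws) ^ (2:ℕ) + 8 * (1 - q) ^ (2:ℕ) * wu * (1 - wu) * ws * (1 - ws) +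
    4 * q * (1 - q) * (1 - wu) ^ (2:ℕ) * (1 - ws) ^ (2:ℕ) + 8 * q * (1 - q) * (1 - wu) ^ (2:ℕ) * ws * (1 - ws) +
    8 * q * (1 - q) * wu * (1 - wu) * (1 - ws) ^ (2:ℕ) + 4 * q * (1 - q) * wu * (1 - wu) * ws * (1 - ws) +
    1 * q ^ (2:ℕ) * (1 - wu) ^ (2:ℕ) * (1 - ws) ^ (2:ℕ) + 2 * q ^ (2:ℕ) * (1 - wu) ^ (2:ℕ) * ws * (1 - ws) +
    2 * q ^ (2:ℕ) * wu * (1 - wu) * (1 - ws) ^ (2:ℕ) := by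
  simp only [condA, roofR0, xwR, zwR]; ring

/-- `condA(R₀(w_u), R₁(w_s))` as a tensor-Bernstein combination with non-negative coefficients. [folklore] -/
theorem condA_roofR0_roofR1 (q wu ws : ℝ) : condA q (roofR0 q wu) (roofR1 q ws) =
    8 * (1 - q) ^ (2:ℕ) * (1 - wu) ^ (2:ℕ) * (1 - ws) ^ (2:ℕ) + 16 * (1 - q) ^ (2:ℕ) * (1 - wu) ^ (2:ℕ) * ws * (1 - ws) +
    4 * (1 - q) ^ (2:ℕ) * (1 - wu) ^ (2:ℕ) * ws ^ (2:ℕ) + 8 * (1 - q) ^ (2:ℕ) * wu * (1 - wu) * (1 - ws) ^ (2:ℕ) +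
    8 * (1 - q) ^ (2:ℕ) * wu * (1 - wu) * ws * (1 - ws) + 8 * q * (1 - q) * (1 - wu) ^ (2:ℕ) * (1 - ws) ^ (2:ℕ) +
    16 * q * (1 - q) * (1 - wu) ^ (2:ℕ) * ws * (1 - ws) + 4 * q * (1 - q) * (1 - wu) ^ (2:ℕ) * ws ^ (2:ℕ) +
    8 * q * (1 - q) * wu * (1 - wu) * (1 - ws) ^ (2:ℕ) + 4 * q * (1 - q) * wu * (1 - wu) * ws * (1 - ws) +
    2 * q ^ (2:ℕ) * (1 - wu) ^ (2:ℕ) * (1 - ws) ^ (2:ℕ) + 4 * q ^ (2:ℕ) * (1 - wu) ^ (2:ℕ) * ws * (1 - ws) +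
    1 * q ^ (2:ℕ) * (1 - wu) ^ (2:ℕ) * ws ^ (2:ℕ) + 2 * q ^ (2:ℕ) * wu * (1 - wu) * (1 - ws) ^ (2:ℕ) := by
  simp only [condA, roofR0, roofR1, xwR, zwR]; ring

/-- `condA(R₁(w_u), R₁(w_s))` as a tensor-Bernstein combination with non-negative coefficients. [folklore] -/
theorem condA_roofR1_roofR1 (q wu ws : ℝ) : condA q (roofR1 q wu) (roofR1 q ws) =
    8 * (1 - q) ^ (3:ℕ) * (1 - wu) ^ (2:ℕ) * (1 - ws) ^ (2:ℕ) + 8 * (1 - q) ^ (3:ℕ) * (1 - wu) ^ (2:ℕ) * ws * (1 - ws) +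
    8 * (1 - q) ^ (3:ℕ) * wu * (1 - wu) * (1 - ws) ^ (2:ℕ) + 8 * (1 - q) ^ (3:ℕ) * wu * (1 - wu) * ws * (1 - ws) +
    20 * q * (1 - q) ^ (2:ℕ) * (1 - wu) ^ (2:ℕ) * (1 - ws) ^ (2:ℕ) + 24 * q * (1 - q) ^ (2:ℕ) * (1 - wu) ^ (2:ℕ) * ws * (1 - ws) +
    4 * q * (1 - q) ^ (2:ℕ) * (1 - wu) ^ (2:ℕ) * ws ^ (2:ℕ) + 24 * q * (1 - q) ^ (2:ℕ) * wu * (1 - wu) * (1 - ws) ^ (2:ℕ) +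
    12 * q * (1 - q) ^ (2:ℕ) * wu * (1 - wu) * ws * (1 - ws) + 4 * q * (1 - q) ^ (2:ℕ) * wu ^ (2:ℕ) * (1 - ws) ^ (2:ℕ) +
    14 * q ^ (2:ℕ) * (1 - q) * (1 - wu) ^ (2:ℕ) * (1 - ws) ^ (2:ℕ) + 18 * q ^ (2:ℕ) * (1 - q) * (1 - wu) ^ (2:ℕ) * ws * (1 - ws) +
    4 * q ^ (2:ℕ) * (1 - q) * (1 - wu) ^ (2:ℕ) * ws ^ (2:ℕ) + 18 * q ^ (2:ℕ) * (1 - q) * wu * (1 - wu) * (1 - ws) ^ (2:ℕ) +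
    4 * q ^ (2:ℕ) * (1 - q) * wu * (1 - wu) * ws * (1 - ws) + 4 * q ^ (2:ℕ) * (1 - q) * wu ^ (2:ℕ) * (1 - ws) ^ (2:ℕ) +
    3 * q ^ (3:ℕ) * (1 - wu) ^ (2:ℕ) * (1 - ws) ^ (2:ℕ) + 4 * q ^ (3:ℕ) * (1 - wu) ^ (2:ℕ) * ws * (1 - ws) +
    1 * q ^ (3:ℕ) * (1 - wu) ^ (2:ℕ) * ws ^ (2:ℕ) + 4 * q ^ (3:ℕ) * wu * (1 - wu) * (1 - ws) ^ (2:ℕ) +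
    1 * q ^ (3:ℕ) * wu ^ (2:ℕ) * (1 - ws) ^ (2:ℕ) := by
  simp only [condA, roofR1, xwR, zwR]; ring

/-- **`condA ≥ 0` at every pair of parts generators** (`0 ≤ q ≤ 1`). [folklore] -/
theorem condA_isGenP_nonneg (hq0 : 0 ≤ q) (hq1 : q ≤ 1) {P S : P6} (hP : IsGenP q P) (hS : IsGenP q S) : 0 ≤ condA q P S := by
  have hp : 0 ≤ 1 - q := sub_nonneg.2 hq1
  have h2q : 0 ≤ 2 - q := by linarith
  -- the `xv`, `yz`, `uv` coordinates of a generator, and the closed forms needed below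
  have hxv : ∀ {T : P6}, IsGenP q T → 0 ≤ T.xv := fun hT => xv_nonneg_of_isGenP hq1 hT
  -- reduce the left generator
  rcases hP with rfl | rfl | rfl | rfl | rfl | ⟨wu, hwu0, hwu1, rfl | rfl⟩
  · -- A: condA(A,S) = S.xv
    have e : condA q rayA S = S.xv := by simp only [condA, rayA]; ring
    rw [e]; exact hxv hS
  · -- D: condA(D,S) = 0
    have e : condA q rayD S = 0 := by simp only [condA, rayD]; ring
    rw [e]
  · rw [condA_rayAC_left]; exact hxv hS
  · -- BD: condA(BD,S) = (1-q) S.yz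
    have e : condA q rayBD S = (1 - q) * S.yz := by simp only [condA, rayBD]; ring
    rw [e]
    have hyz : 0 ≤ S.yz := by
      rcases hS with rfl | rfl | rfl | rfl | rfl | ⟨w, hw0, hw1, rfl | rfl⟩
      · simp [rayA]
      · simp [rayD]
      · simp [rayAC]
      · simp [rayBD]
      · simp [rayOne]
      · simp [roofR0]
      · have hz : 0 ≤ zwR q w := by simp only [zwR]; nlinarith [mul_nonneg hw0 hp, mul_nonneg hw0 hw0]
        simp only [roofR1]; nlinarith [mul_nonneg hw0 (sub_nonneg.2 hw1)]
    exact mul_nonneg hp hyz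
  · -- One on the left: case on S
    rcases hS with rfl | rfl | rfl | rfl | rfl | ⟨w, hw0, hw1, rfl | rfl⟩
    · rw [condA_comm]; have e : condA q rayA rayOne = (rayOne : P6).xv := by simp only [condA, rayA]; ring
      rw [e]; simp [rayOne]
    · rw [condA_comm]; have e : condA q rayD rayOne = 0 := by simp only [condA, rayD]; ring
      rw [e]
    · rw [condA_comm, condA_rayAC_left]; simp [rayOne]
    · rw [condA_comm]; have e : condA q rayBD rayOne = (1 - q) := by simp only [condA, rayBD, rayOne]; ring
      rw [e]; exact hp
    · rw [condA_rayOne_rayOne]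
    · rw [condA_rayOne_roofR0]; positivity
    · rw [condA_rayOne_roofR1]; exact mul_nonneg (mul_nonneg hq0 h2q) (sq_nonneg _)
  · -- R0(wu) on the left
    have hwu1' : 0 ≤ 1 - wu := sub_nonneg.2 hwu1
    rcases hS with rfl | rfl | rfl | rfl | rfl | ⟨ws, hws0, hws1, rfl | rfl⟩
    · rw [condA_comm]; have e : condA q rayA (roofR0 q wu) = (roofR0 q wu).xv := by simp only [condA, rayA]; ring
      rw [e]; exact hxv (isGenP_roofR0 q hwu0 hwu1)
    · rw [condA_comm]; have e : condA q rayD (roofR0 q wu) = 0 := by simp only [condA, rayD]; ring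
      rw [e]
    · rw [condA_comm, condA_rayAC_left]; exact hxv (isGenP_roofR0 q hwu0 hwu1)
    · rw [condA_comm]; have e : condA q rayBD (roofR0 q wu) = 0 := by simp only [condA, rayBD, roofR0]; ring
      rw [e]
    · rw [condA_comm, condA_rayOne_roofR0]; positivity
    · have hws1' : 0 ≤ 1 - ws := sub_nonneg.2 hws1
      rw [condA_roofR0_roofR0]; positivity
    · have hws1' : 0 ≤ 1 - ws := sub_nonneg.2 hws1
      rw [condA_roofR0_roofR1]; positivity
  · -- R1(wu) on the left
    have hwu1' : 0 ≤ 1 - wu := sub_nonneg.2 hwu1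
    rcases hS with rfl | rfl | rfl | rfl | rfl | ⟨ws, hws0, hws1, rfl | rfl⟩
    · rw [condA_comm]; have e : condA q rayA (roofR1 q wu) = (roofR1 q wu).xv := by simp only [condA, rayA]; ring
      rw [e]; exact hxv (isGenP_roofR1 q hwu0 hwu1)
    · rw [condA_comm]; have e : condA q rayD (roofR1 q wu) = 0 := by simp only [condA, rayD]; ring
      rw [e]
    · rw [condA_comm, condA_rayAC_left]; exact hxv (isGenP_roofR1 q hwu0 hwu1)
    · rw [condA_comm]; have e : condA q rayBD (roofR1 q wu) = (1 - q) * (roofR1 q wu).yz := by simp only [condA, rayBD]; ring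
      rw [e]
      have hz : 0 ≤ zwR q wu := by simp only [zwR]; nlinarith [mul_nonneg hwu0 hp, mul_nonneg hwu0 hwu0]
      have hyz : 0 ≤ (roofR1 q wu).yz := by simp only [roofR1]; nlinarith [mul_nonneg hwu0 hwu1']
      exact mul_nonneg hp hyz
    · rw [condA_comm, condA_rayOne_roofR1]; exact mul_nonneg (mul_nonneg hq0 h2q) (sq_nonneg _)
    · have hws1' : 0 ≤ 1 - ws := sub_nonneg.2 hws1
      rw [condA_comm, condA_roofR0_roofR1]; positivity
    · have hws1' : 0 ≤ 1 - ws := sub_nonneg.2 hws1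
      rw [condA_roofR1_roofR1]; positivity

end CondA

/-! ### The identity word is free -/

section III

variable {q : ℝ} {x1 y1 x2 y2 : ℝ}

/-- **The identity word is free**: `PartsOK q 2 2 2 x1 y1 x2 y2` for every `q ∈ [0,1]` and all spokes in `[0,1]`. [folklore] -/
theorem partsOK_III (hq0 : 0 ≤ q) (hq1 : q ≤ 1) (hx11 : x1 ≤ 1) (hy11 : y1 ≤ 1) (hx21 : x2 ≤ 1) (hy21 : y2 ≤ 1) :
    PartsOK q 2 2 2 x1 y1 x2 y2 := by
  intro P S hP hS
  rw [pcell2_III]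
  have h1 : 0 ≤ (1 - x1) * (1 - y1) * ((1 - x2) * (1 - y2)) :=
    mul_nonneg (mul_nonneg (sub_nonneg.2 hx11) (sub_nonneg.2 hy11)) (mul_nonneg (sub_nonneg.2 hx21) (sub_nonneg.2 hy21))
  exact mul_nonneg (mul_nonneg (sub_nonneg.2 hq1) h1) (condA_isGenP_nonneg hq0 hq1 hP hS)

end III

end ThreeApex

end FK

end Summit.CriticalPhenomena.PercolationContinuityZ3.Theorems
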